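import Summits.Ventures.PercRepro.GenQClassTwelveSeventeen

/-!
# PercRepro — the corank-`12` split, part H: one `17`-trace leaves at most two `16`-traces (night-4, gen 15)

At `n = 19` with a `17`-trace `K` (two points of `G` outside `K`): a `16`-trace `L` meets `K` in a rank-`5` flat
`K ∩ L` with `≥ 14 = 17 + 16 − 19` points of `G` (`inter_mem_flatsQ_five_of_two_traces`, the two-size form of
`exists_card_inter_of_two_traces`), and `≤ 15` (`16` would put the spanning trace of `L` inside a rank-`5` flat).
Two `16`-traces `L, L'` share `≥ 13 = 2·16 − 19` points of `G`, of which `≥ 11` lie in `K`, so the rank-`5` flats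
`K ∩ L` and `K ∩ L'` share `≥ 11` points and COINCIDE (flats of rank `≤ 4` have `≤ 10` points):
`inter_eq_inter_of_sixteen_traces`.  Every `16`-trace therefore contains ONE rank-`5` flat `F ⊆ K` and is determined
by its trace outside `K` — a subset of the two-point set `G ∖ K` of the common size `16 − |F ∩ G|` — so there are at
most two of them: **`hypTr_sixteen_le_two_of_seventeen_pos`**, `h₁₇ ≥ 1 ⇒ h₁₆ ≤ 2`.  Consequently the classes
`(h₁₇ = 1, h₁₆ = 3, h₁₅ = 2)` (`−5,960` on tree rows, kit j271962 case 12) and `(h₁₇ = 1, h₁₆ = 4, h₁₅ = 2)` of the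
corank-`12` split are EMPTY, and every class `h₁₇ ≤ 1 ∧ h₁₆ ≥ 3` is its `h₁₇ = 0` half.  Imports
`GenQClassTwelveSeventeen` (parts A–D).
-/
namespace PercRepro.Night4

open Finset ThmH SixFour GenQ PerFlat Star

variable {α : Type*} [DecidableEq α] {M : Matroid α} [M.Finite]

/-- Two distinct spanning traces of sizes `s`, `s'` with `s + s' − n > 10` meet in a rank-`5` flat with
`≥ s + s' − n` points of `G` (the two-size form of `exists_card_inter_of_two_traces`). -/
theorem inter_mem_flatsQ_five_of_two_traces (hB : ∀ a ≤ 7 - 3, ∀ K ∈ flatsQ M a, K.card ≤ 10) {G K L : Finset α}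
    {s s' : ℕ} (hK : K ∈ flatsTr M G 6 s) (hL : L ∈ flatsTr M G 6 s') (hne : K ≠ L)
    (hlarge : 10 < s + s' - G.card) :
    K ∩ L ∈ flatsQ M 5 ∧ s + s' - G.card ≤ ((K ∩ L) ∩ G).card := by
  have hK1 := mem_flatsTr.1 hK
  have hL1 := mem_flatsTr.1 hL
  have hcount : s + s' - G.card ≤ ((K ∩ L) ∩ G).card := by
    have hU : (K ∩ G) ∪ (L ∩ G) ⊆ G := by
      intro x hx
      simp only [Finset.mem_union, Finset.mem_inter] at hx
      rcases hx with hx | hx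
      · exact hx.2
      · exact hx.2
    have h1 := Finset.card_union_add_card_inter (K ∩ G) (L ∩ G)
    have h2 := Finset.card_le_card hU
    rw [hK1.2.1, hL1.2.1, ← inter_inter_eq] at h1
    omega
  refine ⟨?_, hcount⟩
  have hLflat : M.IsFlat (L : Set α) := (mem_flatsQ.1 hL1.1).2.1
  have hnot : ¬ K ⊆ L := fun hsub => hne (eq_of_subset_of_mem_flatsQ hK1.1 hL1.1 hsub)
  obtain ⟨b, hKL, hb⟩ := exists_inter_mem_flatsQ_lt_of_not_subset hK1.1 hLflat hnot
  have hb5 : b = 5 := by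
    by_contra hne5
    have hle := hB b (by omega) _ hKL
    have := Finset.card_le_card (Finset.inter_subset_left : (K ∩ L) ∩ G ⊆ K ∩ L)
    omega
  rw [hb5] at hKL
  exact hKL

/-- With a `17`-trace `K` at `n = 19`, a `16`-trace meets `K` in a rank-`5` flat with `14` or `15` points of `G`. -/
theorem inter_seventeen_sixteen (hB : ∀ a ≤ 7 - 3, ∀ K ∈ flatsQ M a, K.card ≤ 10) {G K L : Finset α}
    (hcard : G.card = 19) (hK : K ∈ flatsTr M G 6 17) (hL : L ∈ flatsTr M G 6 16) :
    K ∩ L ∈ flatsQ M 5 ∧ 14 ≤ ((K ∩ L) ∩ G).card ∧ ((K ∩ L) ∩ G).card ≤ 15 := by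
  have hne : K ≠ L := ne_of_mem_flatsTr_of_card_ne hK hL (by norm_num)
  obtain ⟨hF, h14⟩ := inter_mem_flatsQ_five_of_two_traces hB hK hL hne (by omega)
  refine ⟨hF, by omega, ?_⟩
  by_contra h16
  have hL1 := mem_flatsTr.1 hL
  have hsub : (K ∩ L) ∩ G ⊆ L ∩ G := by
    intro x hx
    rw [Finset.mem_inter] at hx ⊢
    exact ⟨(Finset.mem_inter.1 hx.1).2, hx.2⟩
  have heq : (K ∩ L) ∩ G = L ∩ G := Finset.eq_of_subset_of_card_le hsub (by omega)
  exact not_subset_of_mem_flatsTr_six hF hL (by rw [← heq]; exact Finset.inter_subset_left)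

/-- With a `17`-trace `K` at `n = 19`, two `16`-traces meet `K` in the SAME rank-`5` flat: they share `≥ 13`
points of `G`, `≥ 11` of them in `K`. -/
theorem inter_eq_inter_of_sixteen_traces (hB : ∀ a ≤ 7 - 3, ∀ K ∈ flatsQ M a, K.card ≤ 10) {G K L L' : Finset α}
    (hcard : G.card = 19) (hK : K ∈ flatsTr M G 6 17) (hL : L ∈ flatsTr M G 6 16) (hL' : L' ∈ flatsTr M G 6 16) :
    K ∩ L = K ∩ L' := by
  have hK1 := mem_flatsTr.1 hK
  obtain ⟨hFL, -, -⟩ := inter_seventeen_sixteen hB hcard hK hL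
  obtain ⟨hFL', -, -⟩ := inter_seventeen_sixteen hB hcard hK hL'
  have h13 := two_mul_sub_le_card_inter_of_mem_flatsTr hL hL'
  have hD : (G \ K).card = 2 := by
    rw [Finset.card_sdiff, hK1.2.1, hcard]
  have hsub : (L ∩ L') ∩ G ⊆ ((K ∩ L) ∩ (K ∩ L')) ∪ (G \ K) := by
    intro x hx
    simp only [Finset.mem_inter] at hx
    simp only [Finset.mem_union, Finset.mem_inter, Finset.mem_sdiff]
    by_cases hxK : x ∈ K
    · exact Or.inl ⟨⟨hxK, hx.1.1⟩, ⟨hxK, hx.1.2⟩⟩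
    · exact Or.inr ⟨hx.2, hxK⟩
  have h11 : 11 ≤ ((K ∩ L) ∩ (K ∩ L')).card := by
    have h1 := Finset.card_le_card hsub
    have h2 := Finset.card_union_le ((K ∩ L) ∩ (K ∩ L')) (G \ K)
    omega
  by_contra hneF
  have hnot : ¬ K ∩ L ⊆ K ∩ L' := fun hsub' => hneF (eq_of_subset_of_mem_flatsQ hFL hFL' hsub')
  obtain ⟨b, hFF, hb⟩ := exists_inter_mem_flatsQ_lt_of_not_subset hFL (mem_flatsQ.1 hFL').2.1 hnot
  have := hB b (by omega) _ hFF
  omega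

/-- The trace of a flat `L` on `G` splits along `K`: the part inside `K ∩ L` and the part outside `K`. -/
theorem inter_eq_union_sdiff {G K L : Finset α} : L ∩ G = ((K ∩ L) ∩ G) ∪ ((L ∩ G) \ K) := by
  ext x
  simp only [Finset.mem_union, Finset.mem_inter, Finset.mem_sdiff]
  tauto

/-- The part of the trace of `L` outside `K` has `|L ∩ G| − |(K ∩ L) ∩ G|` points. -/
theorem card_sdiff_trace {G K L : Finset α} : ((L ∩ G) \ K).card = (L ∩ G).card - ((K ∩ L) ∩ G).card := by
  rw [Finset.card_sdiff, Finset.inter_assoc]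

/-- **One `17`-trace leaves at most two `16`-traces** (`n = 19`, the core): all `16`-traces contain one rank-`5`
flat `F ⊆ K` and are determined by their traces outside `K`, subsets of the two points of `G ∖ K` of one common
size. -/
theorem hypTr_sixteen_le_two_of_seventeen_pos (hs : Simple M) (hline : ∀ L ∈ flatsQ M 2, L.card ≤ 3)
    (hplane : ∀ P ∈ flatsQ M 3, P.card ≤ 6) (hsolid : ∀ F ∈ flatsQ M 4, F.card ≤ 10) {G : Finset α}
    (hcard : G.card = 19) (h17 : 1 ≤ hypTr M G 6 17) : hypTr M G 6 16 ≤ 2 := by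
  have hB := flats_le_four_card_le_ten hs hline hplane hsolid
  unfold hypTr at h17 ⊢
  obtain ⟨K, hK⟩ := Finset.card_pos.1 (by omega : 0 < (flatsTr M G 6 17).card)
  by_contra hlt
  rw [not_le] at hlt
  obtain ⟨L₁, L₂, L₃, hL₁, hL₂, hL₃, h12, h13, h23⟩ := Finset.two_lt_card_iff.1 hlt
  have hK1 := mem_flatsTr.1 hK
  have hD : (G \ K).card = 2 := by
    rw [Finset.card_sdiff, hK1.2.1, hcard]
  -- the common rank-`5` flat
  have hF12 := inter_eq_inter_of_sixteen_traces hB hcard hK hL₁ hL₂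
  have hF13 := inter_eq_inter_of_sixteen_traces hB hcard hK hL₁ hL₃
  -- the outside parts: subsets of `G ∖ K` of one common size, pairwise distinct
  have hmem : ∀ L ∈ flatsTr M G 6 16, K ∩ L = K ∩ L₁ →
      (L ∩ G) \ K ∈ (G \ K).powersetCard (16 - ((K ∩ L₁) ∩ G).card) := by
    intro L hL hKL
    have hL1 := mem_flatsTr.1 hL
    refine Finset.mem_powersetCard.2 ⟨?_, ?_⟩
    · intro x hx
      rw [Finset.mem_sdiff, Finset.mem_inter] at hx
      exact Finset.mem_sdiff.2 ⟨hx.1.2, hx.2⟩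
    · rw [card_sdiff_trace, hL1.2.1, hKL]
  have hdist : ∀ L ∈ flatsTr M G 6 16, ∀ L' ∈ flatsTr M G 6 16, K ∩ L = K ∩ L' →
      (L ∩ G) \ K = (L' ∩ G) \ K → L = L' := by
    intro L hL L' hL' hKL hS
    refine eq_of_inter_eq_of_mem_flatsTr hL hL' ?_
    rw [inter_eq_union_sdiff (K := K) (L := L), inter_eq_union_sdiff (K := K) (L := L'), hKL, hS]
  have hS1 := hmem L₁ hL₁ rfl
  have hS2 := hmem L₂ hL₂ hF12.symm
  have hS3 := hmem L₃ hL₃ hF13.symm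
  have hne12 : (L₁ ∩ G) \ K ≠ (L₂ ∩ G) \ K := fun h => h12 (hdist L₁ hL₁ L₂ hL₂ hF12 h)
  have hne13 : (L₁ ∩ G) \ K ≠ (L₃ ∩ G) \ K := fun h => h13 (hdist L₁ hL₁ L₃ hL₃ hF13 h)
  have hne23 : (L₂ ∩ G) \ K ≠ (L₃ ∩ G) \ K := fun h => h23 (hdist L₂ hL₂ L₃ hL₃ (hF12.symm.trans hF13) h)
  have hthree : 2 < ((G \ K).powersetCard (16 - ((K ∩ L₁) ∩ G).card)).card :=
    Finset.two_lt_card_iff.2 ⟨_, _, _, hS1, hS2, hS3, hne12, hne13, hne23⟩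
  rw [Finset.card_powersetCard, hD] at hthree
  -- `Nat.choose 2 k ≤ 2` for every `k`
  have hk : 16 - ((K ∩ L₁) ∩ G).card ≤ 2 := by
    have := Finset.card_le_card (Finset.mem_powersetCard.1 hS1).1
    rw [(Finset.mem_powersetCard.1 hS1).2, hD] at this
    exact this
  generalize 16 - ((K ∩ L₁) ∩ G).card = k at hthree hk
  interval_cases k <;> simp at hthree

end PercRepro.Night4
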